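import Mathlib
import HarnessLib
import Summits.FinalStateConjecture.FinalStateConjecture.Theorems.BondiDrainDispersalDrainImpliesDisperseSlabAchronal
import Literature.Geometry.Lorentzian.CauchyDevelopmentRestrict
import Literature.Geometry.Lorentzian.ClockAdaptedFrameBound
import Literature.Geometry.Lorentzian.CoordSlice

/-!
# Crux `DrainImpliesDisperse` (stmt-FinalStateConjecture-17283), negative side, chart rigidity:
# estimates in a GLOBAL near-Minkowski frame

A **global near-Minkowski frame** of the spacetime `𝓢 = (M, g, τ)` is a pair of mutually inverse
smooth maps `Θ : E4 → M`, `Ξ : M → E4` (`Θ (Ξ p) = p`) such that `Θ` is `C⁰`-PINCHED,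
`‖(Θ^* g − η)(x)‖ < 1/4` for all `x` (operator norm of `Spacetime.deviation`), and FUTURE-ORIENTED,
`Θ_* ∂₀` future-directed. In such a frame every tangent vector `X ∈ T_p M` has the coordinate
expression `V = dΞ_p X` with `X = dΘ (V)` (`mfderiv_frame_apply`), and `g(X, X) = (Θ^* g)(V, V)`
is pinched between `(3/4)‖V̲‖² − (5/4)(V⁰)²` and `(5/4)‖V̲‖² − (3/4)(V⁰)²`
(`frame_lower`/`frame_upper`); a future timelike `X` has `V⁰ > 0` (`frame_apply_zero_pos`, the
timecone lemma against `Θ_* ∂₀`). For a second chart `Φ : U → M` (`U ⊆ E4` open) pinched at a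
point `x`, `‖(Φ^* g − η)(x)‖ < 1/4`, the slab vectors `Φ_* (0, w)` satisfy
`g ≥ (3/4)‖w‖²` and `Φ_* ∂₀` satisfies `g ≤ −3/4` (`chart_slab_lower`, `chart_time_upper`);
combining, the frame coordinates `V_w = dΞ Φ_* (0, w)` and `V₀ = dΞ Φ_* ∂₀` obey
`‖V̲_w‖ ≥ (3/4)‖w‖` and `V₀⁰ ≥ 3/4` (`norm_spatial_frame_slab_ge`, `frame_time_apply_zero_ge`) —
the two inequalities behind the properness of pinched entire late charts in a framed spacetime
(`…FramedProper`). Elementary algebra of pinched bilinear forms on `E4` (O'Neill 1983, Ch. 5,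
Lemma 5.26 in perturbative form) and the chain rule. Line lead
`prover-line-stmt-FinalStateConjecture-17283-c5-0`, 2026-08-17.
-/

noncomputable section

set_option linter.dupNamespace false -- D-0017: `Summit.<S>.<S>.…` by design

open Set Function Filter TopologicalSpace Topology
open scoped Manifold ContDiff Topology

namespace Summit.FinalStateConjecture.FinalStateConjecture.Theorems.DrainImpliesDisperse.FramedProper

open Literature.Geometry.Lorentzian SlabAchronal

/-! ### Algebra of pinched forms on `E4` -/

/-- `η(V, V) = ‖V̲‖² − (V⁰)²` in the time/space splitting of `E4`. [folklore] -/
theorem bilin_self_eq_spatial (V : E4) :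
    Minkowski.bilin V V = ‖E4.spatial V‖ ^ 2 - V 0 ^ 2 := by
  rw [Minkowski.bilin_apply_self_eq_norm_sq_sub, CoordSlice.norm_sq_eq]
  ring

/-- **Two-sided pinching**: if `‖G − η‖ < 1/4` then
`(3/4)‖V̲‖² − (5/4)(V⁰)² ≤ G(V, V) ≤ (5/4)‖V̲‖² − (3/4)(V⁰)²`. O'Neill 1983, Ch. 5, Lemma 5.26
(perturbative form). [cite: ONeillSemiRiemannian1983, Ch. 5, Lemma 5.26] -/
theorem pinched_self_bounds {G : E4 →L[ℝ] E4 →L[ℝ] ℝ} (hG : ‖G - Minkowski.bilin‖ < 1 / 4) (V : E4) :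
    3 / 4 * ‖E4.spatial V‖ ^ 2 - 5 / 4 * V 0 ^ 2 ≤ G V V ∧
      G V V ≤ 5 / 4 * ‖E4.spatial V‖ ^ 2 - 3 / 4 * V 0 ^ 2 := by
  set h : E4 →L[ℝ] E4 →L[ℝ] ℝ := G - Minkowski.bilin with hh
  have hGV : G V V = Minkowski.bilin V V + h V V := by
    rw [hh]
    show G V V = Minkowski.bilin V V + (G V V - Minkowski.bilin V V)
    ring
  have hb := h.le_opNorm₂ V V
  rw [Real.norm_eq_abs] at hb
  have hh0 : 0 ≤ ‖h‖ := norm_nonneg h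
  have hn : ‖V‖ ^ 2 = V 0 ^ 2 + ‖E4.spatial V‖ ^ 2 := CoordSlice.norm_sq_eq V
  have hb' : |h V V| ≤ 1 / 4 * ‖V‖ ^ 2 := by
    calc |h V V| ≤ ‖h‖ * ‖V‖ * ‖V‖ := hb
      _ = ‖h‖ * ‖V‖ ^ 2 := by ring
      _ ≤ 1 / 4 * ‖V‖ ^ 2 := by gcongr
  rw [hGV, bilin_self_eq_spatial]
  obtain ⟨h1, h2⟩ := abs_le.mp hb'
  constructor <;> nlinarith

/-! ### The frame identity `dΘ ∘ dΞ = id` -/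

section Frame

variable (𝓢 : Spacetime 4)
  (Θ : Minkowski.background.domain → 𝓢.carrier) (Ξ : 𝓢.carrier → E4)
  (hΘ : ContMDiff 𝓘(ℝ, E4) (𝓡 4) ∞ Θ) (hΞ : ContMDiff (𝓡 4) 𝓘(ℝ, E4) ∞ Ξ)
  (hΘΞ : ∀ p, Θ ⟨Ξ p, Opens.mem_top _⟩ = p)

include hΞ in
/-- The frame map `Ξ` read in the (full) open submanifold `⊤ ⊆ E4` is smooth. [folklore] -/
theorem contMDiff_frame_cod :
    ContMDiff (𝓡 4) 𝓘(ℝ, E4) ∞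
      (fun p ↦ (⟨Ξ p, Opens.mem_top _⟩ : Minkowski.background.domain)) := by
  intro p
  have hiff : ContMDiffWithinAt (𝓡 4) 𝓘(ℝ, E4) ∞
      (Subtype.val ∘ fun p ↦ (⟨Ξ p, Opens.mem_top _⟩ : Minkowski.background.domain)) univ p ↔
      ContMDiffWithinAt (𝓡 4) 𝓘(ℝ, E4) ∞
        (fun p ↦ (⟨Ξ p, Opens.mem_top _⟩ : Minkowski.background.domain)) univ p :=
    ChartedSpace.liftPropWithinAt_subtypeVal_comp_iff ..
  exact hiff.mp (hΞ p).contMDiffWithinAt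

include hΞ in
/-- The differential of `p ↦ ⟨Ξ p, _⟩` is `dΞ` (the inclusion of `⊤ ⊆ E4` has identity
differential). [folklore] -/
theorem mfderiv_frame_cod_apply (p : 𝓢.carrier) (X : TangentSpace (𝓡 4) p) :
    mfderiv (𝓡 4) 𝓘(ℝ, E4)
        (fun p ↦ (⟨Ξ p, Opens.mem_top _⟩ : Minkowski.background.domain)) p X =
      mfderiv (𝓡 4) 𝓘(ℝ, E4) Ξ p X := by
  set ι : 𝓢.carrier → Minkowski.background.domain := fun p ↦ ⟨Ξ p, Opens.mem_top _⟩ with hι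
  have hιd : MDifferentiableAt (𝓡 4) 𝓘(ℝ, E4) ι p :=
    ((contMDiff_frame_cod 𝓢 Ξ hΞ).mdifferentiable (by simp)) p
  have hval : MDifferentiableAt 𝓘(ℝ, E4) 𝓘(ℝ, E4)
      (Subtype.val : Minkowski.background.domain → E4) (ι p) :=
    ((contMDiff_subtype_val (I := 𝓘(ℝ, E4)) (n := ∞)).mdifferentiable (by simp)) _
  have h := mfderiv_comp p hval hιd
  have h' := DFunLike.congr_fun h X
  rw [mfderiv_subtypeVal] at h'
  exact h'.symm

include hΘ hΞ hΘΞ in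
/-- **The frame identity**: `dΘ_{Ξ p} (dΞ_p X) = X` (chain rule for `Θ ∘ Ξ = id`). [folklore] -/
theorem mfderiv_frame_apply (p : 𝓢.carrier) (X : TangentSpace (𝓡 4) p) :
    mfderiv 𝓘(ℝ, E4) (𝓡 4) Θ ⟨Ξ p, Opens.mem_top _⟩ (mfderiv (𝓡 4) 𝓘(ℝ, E4) Ξ p X) = X := by
  set ι : 𝓢.carrier → Minkowski.background.domain := fun p ↦ ⟨Ξ p, Opens.mem_top _⟩ with hι
  have hιd : MDifferentiableAt (𝓡 4) 𝓘(ℝ, E4) ι p :=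
    ((contMDiff_frame_cod 𝓢 Ξ hΞ).mdifferentiable (by simp)) p
  have hΘd : MDifferentiableAt 𝓘(ℝ, E4) (𝓡 4) Θ (ι p) := (hΘ.mdifferentiable (by simp)) _
  have hcomp : Θ ∘ ι = id := funext fun q ↦ hΘΞ q
  have h := mfderiv_comp p hΘd hιd
  rw [hcomp, mfderiv_id] at h
  have h1 : (mfderiv 𝓘(ℝ, E4) (𝓡 4) Θ (ι p)).comp (mfderiv (𝓡 4) 𝓘(ℝ, E4) ι p) X = X := by
    rw [← h]; rfl
  have h2 : mfderiv 𝓘(ℝ, E4) (𝓡 4) Θ (ι p) (mfderiv (𝓡 4) 𝓘(ℝ, E4) ι p X) = X := h1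
  have hcod : mfderiv (𝓡 4) 𝓘(ℝ, E4) ι p X = mfderiv (𝓡 4) 𝓘(ℝ, E4) Ξ p X :=
    mfderiv_frame_cod_apply 𝓢 Ξ hΞ p X
  rw [hcod] at h2
  exact h2

variable (hpinΘ : ∀ x, ‖𝓢.deviation Minkowski.background Θ x‖ < 1 / 4)

include hΘ hΞ hΘΞ in
/-- **`g` read in the frame**: `g(X, X) = (Θ^* g − η)(V, V) + η(V, V)` with `V = dΞ X`.
[folklore] -/
theorem val_eq_frame (p : 𝓢.carrier) (X : TangentSpace (𝓡 4) p) :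
    𝓢.metric.val p X X =
      (𝓢.deviation Minkowski.background Θ ⟨Ξ p, Opens.mem_top _⟩ + Minkowski.bilin)
        (mfderiv (𝓡 4) 𝓘(ℝ, E4) Ξ p X) (mfderiv (𝓡 4) 𝓘(ℝ, E4) Ξ p X) := by
  have h := mfderiv_frame_apply 𝓢 Θ Ξ hΘ hΞ hΘΞ p X
  have hgen : ∀ (q : 𝓢.carrier) (Y : TangentSpace (𝓡 4) q), q = Θ ⟨Ξ p, Opens.mem_top _⟩ →
      Y = (mfderiv 𝓘(ℝ, E4) (𝓡 4) Θ ⟨Ξ p, Opens.mem_top _⟩ (mfderiv (𝓡 4) 𝓘(ℝ, E4) Ξ p X)) →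
      𝓢.metric.val q Y Y =
        (𝓢.deviation Minkowski.background Θ ⟨Ξ p, Opens.mem_top _⟩ + Minkowski.bilin)
          (mfderiv (𝓡 4) 𝓘(ℝ, E4) Ξ p X) (mfderiv (𝓡 4) 𝓘(ℝ, E4) Ξ p X) := by
    rintro q Y rfl hY
    subst hY
    show _ = 𝓢.deviation Minkowski.background Θ ⟨Ξ p, Opens.mem_top _⟩ _ _ + Minkowski.bilin _ _
    rw [Spacetime.deviation_apply]
    exact (sub_add_cancel _ _).symm
  exact hgen p X (hΘΞ p).symm h.symm

include hΘ hΞ hΘΞ hpinΘ in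
/-- **Frame pinching of `g(X, X)`**: with `V = dΞ X`,
`(3/4)‖V̲‖² − (5/4)(V⁰)² ≤ g(X, X) ≤ (5/4)‖V̲‖² − (3/4)(V⁰)²`. [folklore] -/
theorem frame_bounds (p : 𝓢.carrier) (X : TangentSpace (𝓡 4) p) :
    3 / 4 * ‖E4.spatial (mfderiv (𝓡 4) 𝓘(ℝ, E4) Ξ p X)‖ ^ 2 -
        5 / 4 * E4.time (mfderiv (𝓡 4) 𝓘(ℝ, E4) Ξ p X) ^ 2 ≤ 𝓢.metric.val p X X ∧
      𝓢.metric.val p X X ≤ 5 / 4 * ‖E4.spatial (mfderiv (𝓡 4) 𝓘(ℝ, E4) Ξ p X)‖ ^ 2 -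
        3 / 4 * E4.time (mfderiv (𝓡 4) 𝓘(ℝ, E4) Ξ p X) ^ 2 := by
  rw [val_eq_frame 𝓢 Θ Ξ hΘ hΞ hΘΞ p X]
  refine pinched_self_bounds ?_ _
  have heq : 𝓢.deviation Minkowski.background Θ ⟨Ξ p, Opens.mem_top _⟩ + Minkowski.bilin -
      Minkowski.bilin = 𝓢.deviation Minkowski.background Θ ⟨Ξ p, Opens.mem_top _⟩ :=
    add_sub_cancel_right (𝓢.deviation Minkowski.background Θ ⟨Ξ p, Opens.mem_top _⟩) Minkowski.bilin
  rw [heq]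
  exact hpinΘ _

variable (hfutΘ : ∀ x, 𝓢.timeOrientation.IsFutureDirected
    (mfderiv 𝓘(ℝ, E4) (𝓡 4) Θ x (E4.basisVector 0)))

include hΘ hΞ hΘΞ hpinΘ hfutΘ in
/-- **A future timelike vector has positive frame time component**: if `g(X, X) < 0` and `X` is
future-directed then `(dΞ X)⁰ > 0` (timecone lemma against the future timelike `Θ_* ∂₀`, then
`apply_zero_pos_of_norm_sub_bilin_lt` for the pinched form `Θ^* g`). O'Neill 1983, Ch. 5,
Lemma 5.26 and 5.29 ff. [cite: ONeillSemiRiemannian1983, Ch. 5, Lemma 5.26] -/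
theorem frame_apply_zero_pos (p : 𝓢.carrier) (X : TangentSpace (𝓡 4) p)
    (hX : 𝓢.metric.val p X X < 0) (hXf : 𝓢.timeOrientation.IsFutureDirected X) :
    0 < E4.time (mfderiv (𝓡 4) 𝓘(ℝ, E4) Ξ p X) := by
  set x : Minkowski.background.domain := ⟨Ξ p, Opens.mem_top _⟩ with hx
  set V : E4 := mfderiv (𝓡 4) 𝓘(ℝ, E4) Ξ p X with hV
  set G : E4 →L[ℝ] E4 →L[ℝ] ℝ := 𝓢.deviation Minkowski.background Θ x + Minkowski.bilin with hG
  have hGn : ‖G - Minkowski.bilin‖ < 1 / 4 := by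
    have heq : G - Minkowski.bilin = 𝓢.deviation Minkowski.background Θ x := by
      rw [hG]; exact add_sub_cancel_right (𝓢.deviation Minkowski.background Θ x) Minkowski.bilin
    rw [heq]; exact hpinΘ x
  have hGapp : ∀ u u' : E4, G u u' = 𝓢.metric.val (Θ x) (mfderiv 𝓘(ℝ, E4) (𝓡 4) Θ x u)
      (mfderiv 𝓘(ℝ, E4) (𝓡 4) Θ x u') := by
    intro u u'
    show 𝓢.deviation Minkowski.background Θ x u u' + Minkowski.bilin u u' = _
    rw [Spacetime.deviation_apply]
    exact sub_add_cancel _ _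
  -- everything at the base point `Θ x = p`, with `dΘ V = X`
  have hframe : mfderiv 𝓘(ℝ, E4) (𝓡 4) Θ x V = X := mfderiv_frame_apply 𝓢 Θ Ξ hΘ hΞ hΘΞ p X
  have hgen : ∀ (q : 𝓢.carrier) (Y : TangentSpace (𝓡 4) q), q = Θ x →
      Y = mfderiv 𝓘(ℝ, E4) (𝓡 4) Θ x V →
      𝓢.metric.val q Y Y < 0 → 𝓢.timeOrientation.IsFutureDirected Y →
      G V V < 0 ∧ G V (E4.basisVector 0) < 0 := by
    rintro q Y rfl hY hYY hYf
    subst hY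
    have he1 : 𝓢.metric.val (Θ x) (mfderiv 𝓘(ℝ, E4) (𝓡 4) Θ x (E4.basisVector 0))
        (mfderiv 𝓘(ℝ, E4) (𝓡 4) Θ x (E4.basisVector 0)) < 0 := by
      rw [← hGapp]
      exact Minkowski.apply_basisVector_zero_neg_of_norm_sub_bilin_lt_one (hGn.trans (by norm_num))
    have hor := LorentzianMetric.val_lt_zero_of_isFutureDirected 𝓢.timeOrientation hYY hYf.2 he1
      (hfutΘ x).2
    rw [← hGapp] at hYY hor
    exact ⟨hYY, hor⟩
  obtain ⟨h1, h2⟩ := hgen p X (hΘΞ p).symm hframe.symm hX hXf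
  exact apply_zero_pos_of_norm_sub_bilin_lt hGn h1 h2

end Frame

/-! ### Chart-side pinching -/

section Chart

variable (𝓢 : Spacetime 4) {U : Opens E4} (Φ : U → 𝓢.carrier) (x : U)
  (hpin : ‖𝓢.deviation (Minkowski.backgroundOn U) Φ x‖ < 1 / 4)

include hpin in
/-- **Slab vectors are uniformly spacelike in a pinched chart**:
`g(Φ_*(0, w), Φ_*(0, w)) ≥ (3/4)‖w‖²`. [folklore] -/
theorem chart_slab_lower (w : E3) :
    3 / 4 * ‖w‖ ^ 2 ≤ 𝓢.metric.val (Φ x) (mfderiv 𝓘(ℝ, E4) (𝓡 4) Φ x (CoordSlice.incl w))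
      (mfderiv 𝓘(ℝ, E4) (𝓡 4) Φ x (CoordSlice.incl w)) := by
  set u : E4 := CoordSlice.incl w with hu
  set h : E4 →L[ℝ] E4 →L[ℝ] ℝ := 𝓢.deviation (Minkowski.backgroundOn U) Φ x with hh
  have hval : 𝓢.metric.val (Φ x) (mfderiv 𝓘(ℝ, E4) (𝓡 4) Φ x u) (mfderiv 𝓘(ℝ, E4) (𝓡 4) Φ x u) =
      Minkowski.bilin u u + h u u := by
    rw [hh, Spacetime.deviation_apply]
    exact (add_sub_cancel _ _).symm
  have hun : ‖u‖ ^ 2 = ‖w‖ ^ 2 := by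
    rw [hu, CoordSlice.incl_apply, CoordSlice.norm_ofTimeSpace_sq]; ring
  have hu0 : u 0 = 0 := by rw [hu, CoordSlice.incl_apply]; exact E4.ofTimeSpace_apply_zero 0 w
  have hbil : Minkowski.bilin u u = ‖w‖ ^ 2 := by
    rw [Minkowski.bilin_apply_self_eq_norm_sq_sub, hun, hu0]; ring
  have hb := h.le_opNorm₂ u u
  rw [Real.norm_eq_abs] at hb
  have hh0 : 0 ≤ ‖h‖ := norm_nonneg h
  have hb' : |h u u| ≤ 1 / 4 * ‖w‖ ^ 2 := by
    calc |h u u| ≤ ‖h‖ * ‖u‖ * ‖u‖ := hb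
      _ = ‖h‖ * ‖u‖ ^ 2 := by ring
      _ ≤ 1 / 4 * ‖u‖ ^ 2 := by gcongr
      _ = 1 / 4 * ‖w‖ ^ 2 := by rw [hun]
  rw [hval, hbil]
  obtain ⟨h1, -⟩ := abs_le.mp hb'
  linarith

include hpin in
/-- **The chart time vector is uniformly timelike in a pinched chart**:
`g(Φ_* ∂₀, Φ_* ∂₀) ≤ −3/4`. [folklore] -/
theorem chart_time_upper :
    𝓢.metric.val (Φ x) (mfderiv 𝓘(ℝ, E4) (𝓡 4) Φ x (E4.basisVector 0))
      (mfderiv 𝓘(ℝ, E4) (𝓡 4) Φ x (E4.basisVector 0)) ≤ -(3 / 4) := by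
  set u : E4 := E4.basisVector 0 with hu
  set h : E4 →L[ℝ] E4 →L[ℝ] ℝ := 𝓢.deviation (Minkowski.backgroundOn U) Φ x with hh
  have hval : 𝓢.metric.val (Φ x) (mfderiv 𝓘(ℝ, E4) (𝓡 4) Φ x u) (mfderiv 𝓘(ℝ, E4) (𝓡 4) Φ x u) =
      Minkowski.bilin u u + h u u := by
    rw [hh, Spacetime.deviation_apply]
    exact (add_sub_cancel _ _).symm
  have hun : ‖u‖ = 1 := by rw [hu]; simp [E4.basisVector]
  have hbil : Minkowski.bilin u u = -1 := by rw [hu]; exact Minkowski.bilin_basisVector_zero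
  have hb := h.le_opNorm₂ u u
  rw [Real.norm_eq_abs, hun, mul_one, mul_one] at hb
  rw [hval, hbil]
  obtain ⟨-, h2⟩ := abs_le.mp hb
  linarith

end Chart

/-! ### The two inequalities: slab vectors expand spatially, chart time advances frame time -/

section Combined

variable (𝓢 : Spacetime 4)
  (Θ : Minkowski.background.domain → 𝓢.carrier) (Ξ : 𝓢.carrier → E4)
  (hΘ : ContMDiff 𝓘(ℝ, E4) (𝓡 4) ∞ Θ) (hΞ : ContMDiff (𝓡 4) 𝓘(ℝ, E4) ∞ Ξ)
  (hΘΞ : ∀ p, Θ ⟨Ξ p, Opens.mem_top _⟩ = p)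
  (hpinΘ : ∀ x, ‖𝓢.deviation Minkowski.background Θ x‖ < 1 / 4)
  (hfutΘ : ∀ x, 𝓢.timeOrientation.IsFutureDirected
    (mfderiv 𝓘(ℝ, E4) (𝓡 4) Θ x (E4.basisVector 0)))
  {U : Opens E4} (Φ : U → 𝓢.carrier) (x : U)
  (hpin : ‖𝓢.deviation (Minkowski.backgroundOn U) Φ x‖ < 1 / 4)
  (hfut : 𝓢.timeOrientation.IsFutureDirected (mfderiv 𝓘(ℝ, E4) (𝓡 4) Φ x (E4.basisVector 0)))

include hΘ hΞ hΘΞ hpinΘ hpin in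
/-- **Slab vectors expand spatially in the frame**: `‖(dΞ Φ_*(0, w))̲‖ ≥ (3/4)‖w‖`
(`(3/4)‖w‖² ≤ g ≤ (5/4)‖V̲‖² − (3/4)(V⁰)²`). [folklore] -/
theorem norm_spatial_frame_slab_ge (w : E3) :
    3 / 4 * ‖w‖ ≤ ‖E4.spatial (mfderiv (𝓡 4) 𝓘(ℝ, E4) Ξ (Φ x)
      (mfderiv 𝓘(ℝ, E4) (𝓡 4) Φ x (CoordSlice.incl w)))‖ := by
  set X := mfderiv 𝓘(ℝ, E4) (𝓡 4) Φ x (CoordSlice.incl w) with hX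
  have hlow := chart_slab_lower 𝓢 Φ x hpin w
  have hup := (frame_bounds 𝓢 Θ Ξ hΘ hΞ hΘΞ hpinΘ (Φ x) X).2
  set S := ‖E4.spatial (mfderiv (𝓡 4) 𝓘(ℝ, E4) Ξ (Φ x) X)‖ with hS
  have hS0 : 0 ≤ S := norm_nonneg _
  have hw0 : 0 ≤ ‖w‖ := norm_nonneg _
  have hsq : (3 / 4 * ‖w‖) ^ 2 ≤ S ^ 2 := by
    nlinarith [sq_nonneg (E4.time (mfderiv (𝓡 4) 𝓘(ℝ, E4) Ξ (Φ x) X))]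
  exact (pow_le_pow_iff_left₀ (by positivity) hS0 two_ne_zero).1 hsq

include hΘ hΞ hΘΞ hpinΘ hfutΘ hpin hfut in
/-- **Chart time advances frame time**: `(dΞ Φ_* ∂₀)⁰ ≥ 3/4` (`−3/4 ≥ g ≥ −(5/4)(V⁰)²` and
`V⁰ > 0`). [folklore] -/
theorem frame_time_apply_zero_ge :
    3 / 4 ≤ E4.time (mfderiv (𝓡 4) 𝓘(ℝ, E4) Ξ (Φ x)
      (mfderiv 𝓘(ℝ, E4) (𝓡 4) Φ x (E4.basisVector 0))) := by
  set X := mfderiv 𝓘(ℝ, E4) (𝓡 4) Φ x (E4.basisVector 0) with hX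
  have hup := chart_time_upper 𝓢 Φ x hpin
  have hlow := (frame_bounds 𝓢 Θ Ξ hΘ hΞ hΘΞ hpinΘ (Φ x) X).1
  have hneg : 𝓢.metric.val (Φ x) X X < 0 := hup.trans_lt (by norm_num)
  have hpos := frame_apply_zero_pos 𝓢 Θ Ξ hΘ hΞ hΘΞ hpinΘ hfutΘ (Φ x) X hneg hfut
  set t := E4.time (mfderiv (𝓡 4) 𝓘(ℝ, E4) Ξ (Φ x) X) with ht
  have hsq : (3 / 4 : ℝ) ^ 2 ≤ t ^ 2 := by
    nlinarith [sq_nonneg ‖E4.spatial (mfderiv (𝓡 4) 𝓘(ℝ, E4) Ξ (Φ x) X)‖]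
  exact (pow_le_pow_iff_left₀ (by positivity) hpos.le two_ne_zero).1 hsq

end Combined

/-! ### Registered forms (verbatim signatures) -/

/-- **Slab vectors expand spatially in a global near-Minkowski frame** (registered form of
`norm_spatial_frame_slab_ge`). [folklore] -/
theorem framedChart_slab_expand : ∀ (𝓢 : Literature.Geometry.Lorentzian.Spacetime 4) (Θ : Literature.Geometry.Lorentzian.Minkowski.background.domain → 𝓢.carrier) (Ξ : 𝓢.carrier → Literature.Geometry.Lorentzian.E4), ContMDiff 𝓘(ℝ, Literature.Geometry.Lorentzian.E4) (𝓡 4) ((⊤ : ℕ∞) : WithTop ℕ∞) Θ → ContMDiff (𝓡 4) 𝓘(ℝ, Literature.Geometry.Lorentzian.E4) ((⊤ : ℕ∞) : WithTop ℕ∞) Ξ → (∀ p : 𝓢.carrier, Θ ⟨Ξ p, TopologicalSpace.Opens.mem_top (Ξ p)⟩ = p) → (∀ x : Literature.Geometry.Lorentzian.Minkowski.background.domain, ‖𝓢.deviation Literature.Geometry.Lorentzian.Minkowski.background Θ x‖ < 1 / 4) → ∀ (U : TopologicalSpace.Opens Literature.Geometry.Lorentzian.E4) (Φ : U → 𝓢.carrier)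 (x : U), ‖𝓢.deviation (Literature.Geometry.Lorentzian.Minkowski.backgroundOn U) Φ x‖ < 1 / 4 → ∀ w : Literature.Geometry.Lorentzian.E3, 3 / 4 * ‖w‖ ≤ ‖Literature.Geometry.Lorentzian.E4.spatial (mfderiv (𝓡 4) 𝓘(ℝ, Literature.Geometry.Lorentzian.E4) Ξ (Φ x) (mfderiv 𝓘(ℝ, Literature.Geometry.Lorentzian.E4) (𝓡 4) Φ x (Literature.Geometry.Lorentzian.CoordSlice.incl w)))‖ := by
  intro 𝓢 Θ Ξ hΘ hΞ hΘΞ hpinΘ U Φ x hpin w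
  exact norm_spatial_frame_slab_ge 𝓢 Θ Ξ hΘ hΞ hΘΞ hpinΘ Φ x hpin w

/-- **Chart time advances frame time in a global near-Minkowski frame** (registered form of
`frame_time_apply_zero_ge`). [folklore] -/
theorem framedChart_time_advance : ∀ (𝓢 : Literature.Geometry.Lorentzian.Spacetime 4) (Θ : Literature.Geometry.Lorentzian.Minkowski.background.domain → 𝓢.carrier) (Ξ : 𝓢.carrier → Literature.Geometry.Lorentzian.E4), ContMDiff 𝓘(ℝ, Literature.Geometry.Lorentzian.E4) (𝓡 4) ((⊤ : ℕ∞) : WithTop ℕ∞) Θ → ContMDiff (𝓡 4) 𝓘(ℝ, Literature.Geometry.Lorentzian.E4) ((⊤ : ℕ∞) : WithTop ℕ∞) Ξ → (∀ p : 𝓢.carrier, Θ ⟨Ξ p, TopologicalSpace.Opens.mem_top (Ξ p)⟩ = p) → (∀ x : Literature.Geometry.Lorentzian.Minkowski.background.domain, ‖𝓢.deviation Literature.Geometry.Lorentzian.Minkowski.background Θ x‖ < 1 / 4) → (∀ x : Literature.Geometry.Lorentzian.Minkowski.background.domain, 𝓢.timeOrientation.IsFutureDirected (mfderiv 𝓘(ℝ,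 Literature.Geometry.Lorentzian.E4) (𝓡 4) Θ x (Literature.Geometry.Lorentzian.E4.basisVector 0))) → ∀ (U : TopologicalSpace.Opens Literature.Geometry.Lorentzian.E4) (Φ : U → 𝓢.carrier) (x : U), ‖𝓢.deviation (Literature.Geometry.Lorentzian.Minkowski.backgroundOn U) Φ x‖ < 1 / 4 → 𝓢.timeOrientation.IsFutureDirected (mfderiv 𝓘(ℝ, Literature.Geometry.Lorentzian.E4) (𝓡 4) Φ x (Literature.Geometry.Lorentzian.E4.basisVector 0)) → 3 / 4 ≤ Literature.Geometry.Lorentzian.E4.time (mfderiv (𝓡 4) 𝓘(ℝ, Literature.Geometry.Lorentzian.E4) Ξ (Φ x) (mfderiv 𝓘(ℝ, Literature.Geometry.Lorentzian.E4) (𝓡 4) Φ x (Literature.Geometry.Lorentzian.E4.basisVector 0))) := by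
  intro 𝓢 Θ Ξ hΘ hΞ hΘΞ hpinΘ hfutΘ U Φ x hpin hfut
  exact frame_time_apply_zero_ge 𝓢 Θ Ξ hΘ hΞ hΘΞ hpinΘ hfutΘ Φ x hpin hfut

end Summit.FinalStateConjecture.FinalStateConjecture.Theorems.DrainImpliesDisperse.FramedProper

end
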